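import Summits.ABC.IUTFork.LanaEtaLimDictionary
import Summits.ABC.IUTFork.LanaEtaLimThetaFunctions
import HarnessLib

/-!
# L-LANA dictionary, last clause: [IUTchII] Prop. 3.1 (i)'s "splittings up to torsion" for LANA's Fig. 3 étale side
# FOLLOW from a presentation of `θ(Π_v)` by functions with NON-UNIT values at one label — hence the whole of
# abc-iut-L6-t2's `Prop31Statements` for the record `toThetaEnvData`

Record-only sequel (D-0012; seat abc-iut-c312-4 gen 7, L-LANA level, plan/LLANA-SPEC N14 ↔ layer L6) of
`LanaEtaLimDictionary.lean` (`EtaLimSide.toThetaEnvData`, `conj_permutes_of_stable`) and `LanaEtaLimThetaFunctions.lean`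
(`EtaLimSide.FunctionData`, `res_thetaClassOf_eq_kappaD`). TAKES NO SIDE on [IUTchIII] Cor. 3.12.
[IUTchII] Prop. 3.1 (i) p. 87, as typed by abc-iut-L6-t2 (`TemperedThetaMonoids.Prop31Statements.splitting`:
`IsSplittingUpToTorsion M^×_TM (closure ∞θ^ι_env)` — an element of `M^×_TM` lying in the monoid generated by `∞θ^ι_env`
is TORSION), "splittings up to torsion determined by the subsets `M^×_TM(M^Θ_*)`, `θ^ι_env(M^Θ_*)`, `∞θ^ι_env(M^Θ_*)`".
[cite: Mochizuki2012, Prop 3.1 (i) p.87] The mechanism is abc-iut-w4-d004's (`BadPrimeGaussianMonoidsSplittingOf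
EvaluationProofs`: "no positive power of `θ` is a unit" from the theta EVALUATION at one label with a NON-UNIT value,
[IUTchII] Rmk. 1.12.2 (ii) `q^{j²}` of positive valuation), here in LANA's restriction-to-`D_t` shape over gen 5's
record and gen 7's `FunctionData`. LANA §6.2 (d) p. 34 (`M^Θ_{v,∞} := O^×_v(Π_v) · ∞θ(Π_v)`); §6.2 (g) p. 36 / Rem. 6.2.3
(the theta values `q_v^{t²}`). [cite: LANA2026Report, §6.2 (d) p. 34, §6.2 (g) p. 36]

PROVED (generic `S : EtaLimSide φ A' H A`, `F : S.FunctionData M`):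
§1 `exists_pow_div_mem_closure_thetaClasses` — every element `y` of `⟨∞θ(Π_v)⟩` has a power `y^N` (`N > 0`) equal up to
   torsion to an element of `⟨θ(Π_v)⟩`; `res_closure_thetaClasses_dichotomy` — every `z ∈ ⟨θ(Π_v)⟩` is `1` or restricts at
   the label `t₀` to `κ_{t₀}(a)` with `w(a) < 1`, for any monotone "valuation" `w : A →* Γ` that is `< 1` on the values
   `ev_{t₀}(ϑ_i)`;
§2 **`isSplittingUpToTorsion_of_functionData`** — if moreover `κ_{D_{t₀}}` is injective, `c` is bijective, `w(O^×) = 1`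
   and the torsion of `A` lies in `O^×`: `κ_H(O^×) ∩ ⟨∞θ(Π_v)⟩` consists of TORSION classes (L6-t2's splitting clause for
   `∞Ψ_env = M^Θ_{v,∞}`); **`prop31Statements_of_functionData`** — with the conjugation inputs of `conj_permutes_of_stable`,
   the WHOLE `Prop31Statements (S.toThetaEnvData …)` ([IUTchII] Prop. 3.1 (i)–(ii) statement-level content as typed by
   L6-t2) HOLDS for LANA's Fig. 3 étale side.
HONEST SCOPE: the inputs are the [EtTh] function data (`FunctionData` with a non-unit value at one label — print:
`q_v^{t²}`, `t ≠ 0`) and the Fig. 3 structural hypotheses; nothing is asserted about the genuine theta function.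
NOT here: any judgement.
-/

noncomputable section

namespace Summit.ABC
namespace IUTFork

open Literature.AnabelianGeometry.EtaleTheta
open Literature.IUT.HodgeArakelov
open Literature.IUT.HodgeArakelov.CohomologySystemOfContH1
open Literature.IUT.HodgeArakelov.TemperedThetaMonoids

namespace EtaLimSide

variable {P : TopGroup.{0}} {G' : Type} [Group G'] [TopologicalSpace G'] [IsTopologicalGroup G']
  {φ : P →* G'} {A' : Subgroup G'} [A'.Normal] [IsMulCommutative A'] {H : Subgroup P}
  {A : Type} [CommGroup A] [MulDistribMulAction P A] [TopologicalSpace A] [RootableBy A ℕ]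
  (S : EtaLimSide φ A' H A) {M : Type} [CommGroup M] [MulDistribMulAction P M] [TopologicalSpace M]

/-! ## 1. Powers of elements of `⟨∞θ⟩` are elements of `⟨θ⟩` up to torsion; restriction of `⟨θ⟩` at a label -/

/-- Every element `y` of the monoid `⟨∞θ(Π_v)⟩` generated by `∞θ(Π_v)` has a positive power equal UP TO TORSION to an
element of the monoid `⟨θ(Π_v)⟩` generated by `θ(Π_v)` (generators: `xⁿ/θ₀` torsion; products: raise to the product of
the exponents). [cite: LANA2026Report, §6.2 (d) p. 34] [cite: Mochizuki2012, Prop 1.4 p.27] -/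
theorem exists_pow_div_mem_closure_thetaClasses {y : Multiplicative (h1Lim φ A' H ⊥)}
    (hy : y ∈ Submonoid.closure S.thetaInfSet) :
    ∃ N : ℕ, 0 < N ∧ ∃ z ∈ Submonoid.closure S.thetaClasses, IsOfFinOrder (y ^ N / z) := by
  induction hy using Submonoid.closure_induction with
  | mem x hx =>
    obtain ⟨n, hn, t, ht, hfin⟩ := hx
    exact ⟨n, hn, t, Submonoid.subset_closure ht, hfin⟩
  | one => exact ⟨1, Nat.one_pos, 1, one_mem _, by rw [one_pow, div_one]; exact IsOfFinOrder.one⟩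
  | mul x x' _ _ ih ih' =>
    obtain ⟨N, hN, z, hz, hfin⟩ := ih
    obtain ⟨N', hN', z', hz', hfin'⟩ := ih'
    refine ⟨N * N', Nat.mul_pos hN hN', z ^ N' * z' ^ N, mul_mem (pow_mem hz _) (pow_mem hz' _), ?_⟩
    have h := (hfin.pow (n := N')).mul (hfin'.pow (n := N))
    have heq : (x ^ N / z) ^ N' * (x' ^ N' / z') ^ N = (x * x') ^ (N * N') / (z ^ N' * z' ^ N) := by
      rw [div_pow, div_pow, ← pow_mul, ← pow_mul, div_mul_div_comm, mul_pow, Nat.mul_comm N' N]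
    rw [← heq]
    exact h

/-- **Restriction of `⟨θ(Π_v)⟩` at a label, with a valuation.** For a presentation `F` of `θ(Π_v)` by functions and a
monotone homomorphism `w : A →* Γ` ("valuation") with `w(ev_{t₀} ϑ_i) < 1` for every presenting function: every
`z ∈ ⟨θ(Π_v)⟩` is either `1` or restricts at `D_{t₀}` to `κ_{t₀}(a)` for some `a` with `w a < 1` (products of values).
[cite: LANA2026Report, §6.2 (g) p. 36] [cite: Mochizuki2012, Prop 3.1 (i) p.87] -/
theorem res_closure_thetaClasses_dichotomy (F : S.FunctionData M) (t₀ : S.T) {Γ : Type} [CommMonoid Γ]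
    [PartialOrder Γ] [MulLeftMono Γ] (w : A →* Γ) (hw : ∀ i, w (F.ev t₀ (F.fn i)) < 1)
    {z : Multiplicative (h1Lim φ A' H ⊥)} (hz : z ∈ Submonoid.closure S.thetaClasses) :
    z = 1 ∨ ∃ a : A, AddMonoidHom.toMultiplicative (h1LimRestrict φ A' (S.D_le t₀) ⊥) z = S.kappaD t₀ a ∧
      w a < 1 := by
  -- `res_t` of Fig. 3 IS `h1LimRestrict` (gen 5, by definition); written explicitly to keep the instances syntactic
  induction hz using Submonoid.closure_induction with
  | mem x hx =>
    obtain ⟨i, rfl⟩ := F.thetaClasses_subset hx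
    exact Or.inr ⟨F.ev t₀ (F.fn i), res_thetaClassOf_eq_kappaD F t₀ i, hw i⟩
  | one => exact Or.inl rfl
  | mul x x' _ _ ih ih' =>
    rcases ih with rfl | ⟨a, ha, hwa⟩
    · rw [one_mul]; exact ih'
    · rcases ih' with rfl | ⟨a', ha', hwa'⟩
      · rw [mul_one]; exact Or.inr ⟨a, ha, hwa⟩
      · refine Or.inr ⟨a * a', ?_, ?_⟩
        · rw [map_mul, ha, ha', map_mul]
        · rw [map_mul]
          calc w a * w a' ≤ w a * 1 := by gcongr
            _ < 1 := by rw [mul_one]; exact hwa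

/-! ## 2. The splitting up to torsion, and the whole of `Prop31Statements` -/

/-- **[IUTchII] Prop. 3.1 (i)'s splitting up to torsion for LANA's `M^Θ_{v,∞} = O^×(Π_v)·⟨∞θ(Π_v)⟩` from a
presentation by functions with NON-UNIT values at one label `t₀`** (abc-iut-w4-d004's mechanism in LANA's shape): if
`κ_{D_{t₀}}` is injective, `c` is bijective, `w(O^×) = 1`, the torsion of `A` lies in `O^×`, and `w(ev_{t₀} ϑ_i) < 1` for
all `i`, then every element of `κ_H(O^×) ∩ ⟨∞θ(Π_v)⟩` is TORSION. Proof: `x = κ_H(u)`, `x^N/z` torsion with `z ∈ ⟨θ⟩`; if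
`z = 1`, done; else `res_{t₀} z = κ_{t₀}(a)` with `w a < 1`, and `res_{t₀}(x^N/z) = κ_{t₀}(u^N/a)` torsion forces
`u^N/a = ζ` torsion (gen 7 `exists_kappaD_eq_of_isOfFinOrder` + injectivity), so `w a = 1` — contradiction.
[cite: Mochizuki2012, Prop 3.1 (i) p.87] [cite: LANA2026Report, §6.2 (d) p. 34] -/
theorem isSplittingUpToTorsion_of_functionData (F : S.FunctionData M) (t₀ : S.T)
    (hinj : Function.Injective (S.kappaD t₀)) (hc : Function.Bijective S.c.hom)
    {Γ : Type} [CommMonoid Γ] [PartialOrder Γ] [MulLeftMono Γ] (w : A →* Γ)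
    (hwU : ∀ u ∈ S.units, w u = 1) (htorU : ∀ ζ : A, IsOfFinOrder ζ → ζ ∈ S.units)
    (hw : ∀ i, w (F.ev t₀ (F.fn i)) < 1) :
    IsSplittingUpToTorsion (S.units.map S.kappaH) (Submonoid.closure S.thetaInfSet) := by
  refine ⟨fun x hxU hxθ => ?_⟩
  obtain ⟨u, hu, rfl⟩ := hxU
  obtain ⟨N, hN, z, hz, hfin⟩ := S.exists_pow_div_mem_closure_thetaClasses hxθ
  rcases S.res_closure_thetaClasses_dichotomy F t₀ w hw hz with rfl | ⟨a, ha, hwa⟩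
  · rw [div_one] at hfin
    exact hfin.of_pow (Nat.pos_iff_ne_zero.mp hN)
  · exfalso
    -- restrict to `D_{t₀}`: `κ_{t₀}(u^N / a)` is torsion
    have h1 : IsOfFinOrder (S.kappaD t₀ (u ^ N / a)) := by
      have hRu : AddMonoidHom.toMultiplicative (h1LimRestrict φ A' (S.D_le t₀) ⊥) (S.kappaH u) = S.kappaD t₀ u :=
        S.res_kappaH t₀ u
      have hres : AddMonoidHom.toMultiplicative (h1LimRestrict φ A' (S.D_le t₀) ⊥) (S.kappaH u ^ N / z) =
          S.kappaD t₀ (u ^ N / a) := by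
        rw [map_div, map_pow, hRu, ha, ← map_pow, ← map_div]
      exact hres ▸ (AddMonoidHom.toMultiplicative (h1LimRestrict φ A' (S.D_le t₀) ⊥)).isOfFinOrder hfin
    obtain ⟨ζ, hζ, hκζ⟩ := S.exists_kappaD_eq_of_isOfFinOrder hc t₀ h1
    have hζeq : ζ = u ^ N / a := hinj hκζ
    -- valuations: `w a = w a · w ζ = w (u^N) = 1`
    have hwa1 : w a = 1 := by
      have h2 : a * ζ = u ^ N := by rw [hζeq, mul_div_cancel]
      calc w a = w a * w ζ := by rw [hwU ζ (htorU ζ hζ), mul_one]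
        _ = w (u ^ N) := by rw [← w.map_mul, h2]
        _ = 1 := by rw [w.map_pow, hwU u hu, one_pow]
    exact (lt_irrefl (1 : Γ)) (hwa1 ▸ hwa)

variable [H.Normal]

/-- **The WHOLE of abc-iut-L6-t2's `Prop31Statements` for LANA's Fig. 3 étale side read as `ThetaEnvData`** ([IUTchII]
Prop. 3.1 (i): conjugation action on `{Ψ^ι_env}`, splittings up to torsion; (ii): `Ψ_cns` conjugation-stable) — from: a
presentation of `θ(Π_v)` by functions with non-unit values at one label (splitting), `θ(Π_v)` and `O^×`, `O^▷` stable
under `Π` (conjugation), `κ_H` injective, `κ_{D_{t₀}}` injective, `c` bijective, `O^× = (O^▷)^×`, torsion ⊆ `O^×`,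
`w(O^×) = 1`. [cite: Mochizuki2012, Prop 3.1 p.87] [cite: LANA2026Report, §6.2 (d) p. 34] -/
theorem prop31Statements_of_functionData (hinjH : Function.Injective S.kappaH)
    (hunits : ∀ a : A, a ∈ S.O → a⁻¹ ∈ S.O → a ∈ S.units)
    (hU : ∀ (g : P) (a : A), a ∈ S.units → g • a ∈ S.units)
    (hO : ∀ (g : P) (a : A), a ∈ S.O → g • a ∈ S.O)
    (hθ : ∀ g : P, (h1LimConjMulAut φ A' H g) '' S.thetaClasses = S.thetaClasses)
    (F : S.FunctionData M) (t₀ : S.T) (hinj : Function.Injective (S.kappaD t₀)) (hc : Function.Bijective S.c.hom)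
    {Γ : Type} [CommMonoid Γ] [PartialOrder Γ] [MulLeftMono Γ] (w : A →* Γ)
    (hwU : ∀ u ∈ S.units, w u = 1) (htorU : ∀ ζ : A, IsOfFinOrder ζ → ζ ∈ S.units)
    (hw : ∀ i, w (F.ev t₀ (F.fn i)) < 1) :
    Prop31Statements (S.toThetaEnvData hinjH hunits) where
  conj_permutes := S.conj_permutes_of_stable hinjH hunits hU hθ
  splitting _ := S.isSplittingUpToTorsion_of_functionData F t₀ hinj hc w hwU htorU hw
  constants_stable := S.toThetaEnvData_constantMonoid_isConjStable hinjH hunits hO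

end EtaLimSide

end IUTFork

end Summit.ABC

end
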